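import Summits.ResolutionOfSingularities.ResolutionOfSingularities.Theorems.EquisingularLiftEquisingularLiftNatRegularPointStepExact
import Summits.ResolutionOfSingularities.ResolutionOfSingularities.Theorems.EquisingularLiftEquisingularLiftNatCarrierDeltaModelFrame
import HarnessLib

/-!
# [OURS · L1 W4.5(b) · EL♮(3)] HSUB(ReachTC⁺)₃ brick K7e = T-STCURVE-SING + T-PACK-DESCENT: exactness downstairs after the blow-up of a
# CENTRED (singular) point of the running curve — `St_υ(𝓢̄) ⊔ St_υ(K̄) = 𝓘⟨closure υ⁻¹(Z ∖ {y})⟩` from a downstairs cone pack, and the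
# downstairs cone pack from the upstairs centred package along the model square

Crux `EquisingularLiftNat` = stmt-ResolutionOfSingularities-20038 (child EL♮(3) = stmt-ResolutionOfSingularities-20148), route
EquisingularLift, line `sections`; registered stub `stub_elnat_tcPlusPointResolution`, closing on res-L1-w45b-stub-1's HSUB′(ReachTC⁺)₃
assembly (driver `hsub_reachTCPlus_of_invariant` p526242, brick `inv_step_singular`, clause (i) «exact special fibre» after the step).
Helper file `--supports stmt-ResolutionOfSingularities-20148 --as helper` by res-D-pv-029 (object K7e, cut out of stub-1's `inv_step_singular`
«exactness by F⁺5 with the order-`m` pack»). HONEST FRAMING: OURS (cell res-hironaka, slot W4.5(b)); NOT a statement of any manuscript;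
AI-written, weaker than expert review. No `sorry`; standard axioms.

WHY. At a SINGULAR point `y` of the running reduced curve `V(Zc)_red = V(𝓢̄ ⊔ K̄)` the in-carrier pair is CENTRED (stub-1's
`TCPlus.CentredPackage` at the `O`-point `p = j y` upstairs: a frame `c` of the section ideal with `c₀` generating the carrier, the cone
`K_p = (Φ(c₁, …, c_r))` of order `m`, `Φ ≢ 0 mod 𝔪_p`). After the blow-up `υ` of `y` the downstairs exactness
`St_υ(𝓢̄) ⊔ St_υ(K̄) = 𝓘⟨closure υ⁻¹(Zc ∖ {y})⟩` is K7a (…NatStrictTransformVanishingIdeal p531318/p532268 + …NatRegularPointStepExact p532793)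
with the degree-one cone replaced by the package's order-`m` cone; the frame no longer comes from regularity but DESCENDS from the package.

* **`strictTransformIdeal_sup_eq_vanishingIdeal_of_conePack`** (T-STCURVE-SING) — `G` locally Noetherian, `y` closed, `υ` the blow-up of
  `𝓘{y}`; a DOWNSTAIRS CONE PACK at `y`: `c : Fin (r+1) → 𝒪_{G,y}` with `(c) = 𝔪_y`, `c` quasi-regular, the tail quasi-regular modulo `c₀`,
  `𝓢̄_y = (c₀)`, `K̄_y = (Φ(c₁, …, c_r))` for a form `Φ` of degree `d` with `Φ mod (c) ≠ 0`; and `𝓢̄ ⊔ K̄ = 𝓘⟨closure Z⟩`. THEN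
  `St 𝓢̄ ⊔ St K̄ = 𝓘⟨closure υ⁻¹(Z ∖ {y})⟩` — res-L1-w45b-stub-4's `strictTransformIdeal_sup_eq_vanishingIdeal_point_of_mem_support` at
  `closure Z` with its stalk hypothesis supplied by res-L1-w45b-stub-1's `stalkIdeal_strictTransformIdeal_sup_eq_sup` (p522194), and
  `closure υ⁻¹(closure Z ∖ {y}) = closure υ⁻¹(Z ∖ {y})` (p532793). No regularity of `G` at `y` is asked.
* **`conePack_stalkMap_of_model`** (T-PACK-DESCENT) — in a model square `IsPullback j t r' (Spec θ)` over a DVR `O` (`θ : O ↠ k`, `ϖ` a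
  uniformizer), the UPSTAIRS package data at `j x` (`c` quasi-regular with `𝒪/(c)` a domain, tail quasi-regular mod `c₀`, `ϖ ∉ (c)`,
  `(c) + (ϖ) = 𝔪`, `𝓢_{jx} = (c₀)`, `K_{jx} = (Φ(tail))`, `Φ ≢ 0 mod 𝔪`) DESCEND along `j^♯_x` to exactly the downstairs cone pack of the
  previous item for `(𝓢.comap j, K.comap j)` at `x` (frame `j^♯ ∘ c`, cone `j^♯ Φ`): res-type-100's `span_stalkMap_eq_maximalIdeal_of_model`
  (p524314), res-D-pv-029's `isQuasiRegular_stalkMap_model` / `ker_stalkMap_model_le` / `stalkMap_model_varpi` / `map_mk_map_stalkMap_ne_zero` /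
  `IsQuasiRegular.comp_of_surjective` (p520689), `stalkIdeal_comap_eq_map_stalkMap`;
* `strictTransformIdeal_comap_sup_eq_vanishingIdeal_of_centredPackage` — the two combined: `inv_step_singular` (i) downstairs.

References: H. Matsumura, *Commutative Ring Theory* (1986), Thm. 16.2; U. Görtz, T. Wedhorn, *Algebraic Geometry I* (2020), (13.19),
Prop. 13.96; The Stacks Project, Tags 080C, 080E. Tree inputs: p531318/p532268 (stub-4), p522194 (stub-1), p524314 (res-type-100),
p520689 + p532793 (res-D-pv-029).
-/

set_option linter.dupNamespace false -- mandated namespace `Summit.<Summit>.<Problem>` of this single-conjunct summit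
set_option linter.overlappingInstances false -- signatures carry `[IsDomain O] [IsDiscreteValuationRing O]`

noncomputable section

open CategoryTheory AlgebraicGeometry TopologicalSpace Topology IsLocalRing MvPolynomial
open Literature.AlgebraicGeometry.Resolution
open AlgebraicGeometry.Scheme.IdealSheafData

namespace Summit.ResolutionOfSingularities.ResolutionOfSingularities.Cruxes.EquisingularLiftNat.Sections

/-! ## 1. T-STCURVE-SING: exactness downstairs from a downstairs cone pack -/

/-- **T-STCURVE-SING.** `G` locally Noetherian, `y ∈ G` closed, `υ : G₂ → G` the blow-up of `𝓘{y}`; a downstairs CONE PACK at `y` for the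
ideal sheaves `𝓢̄, K̄` (`(c) = 𝔪_y`, `c` quasi-regular, tail quasi-regular modulo `c₀`, `𝓢̄_y = (c₀)`, `K̄_y = (Φ(c₁, …, c_r))`, `Φ` a form of
degree `d` with `Φ mod (c) ≠ 0`) and `𝓢̄ ⊔ K̄ = 𝓘⟨closure Z⟩`. Then `St_υ(𝓢̄) ⊔ St_υ(K̄) = 𝓘⟨closure υ⁻¹(Z ∖ {y})⟩`.
[cite: GortzWedhorn2020, Prop. 13.96] [cite: StacksProject, Tag 080C] [OURS · L1 W4.5b] brick K7e toward `stub_elnat_tcPlusPointResolution`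
(stmt-ResolutionOfSingularities-20148 / -20038); NOT a statement of the manuscript. -/
theorem strictTransformIdeal_sup_eq_vanishingIdeal_of_conePack {G G₂ : Scheme.{0}} [IsLocallyNoetherian G] (υ : G₂ ⟶ G) {y : G}
    (hy : IsClosed ({y} : Set G)) (hυ : IsBlowup υ (vanishingIdeal ⟨{y}, hy⟩)) (𝓢 K : G.IdealSheafData)
    {r : ℕ} (c : Fin (r + 1) → G.presheaf.stalk y) (hc𝔪 : Ideal.span (Set.range c) = maximalIdeal (G.presheaf.stalk y))
    (hc : IsQuasiRegular c) (hcb : IsQuasiRegular fun l : Fin r => Ideal.Quotient.mk (Ideal.span {c 0}) (c l.succ))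
    (h𝓢 : stalkIdeal 𝓢 y = Ideal.span {c 0}) {d : ℕ} (Φ : MvPolynomial (Fin r) (G.presheaf.stalk y))
    (hΦd : Φ.IsHomogeneous d) (hΦ : MvPolynomial.map (Ideal.Quotient.mk (Ideal.span (Set.range c))) Φ ≠ 0)
    (hK : stalkIdeal K y = Ideal.span {MvPolynomial.eval (fun l => c l.succ) Φ})
    (Z : Set G) (hD : 𝓢 ⊔ K = vanishingIdeal ⟨closure Z, isClosed_closure⟩) :
    strictTransformIdeal υ (vanishingIdeal ⟨{y}, hy⟩) 𝓢 ⊔ strictTransformIdeal υ (vanishingIdeal ⟨{y}, hy⟩) K =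
      vanishingIdeal ⟨closure (υ ⁻¹' (Z \ {y})), isClosed_closure⟩ := by
  haveI : IsProper υ := hυ.isProper
  haveI : IsLocallyNoetherian G₂ := LocallyOfFiniteType.isLocallyNoetherian υ
  haveI : (Ideal.span (Set.range c)).IsMaximal := by rw [hc𝔪]; exact maximalIdeal.isMaximal _
  have hstalk : ∀ x' : G₂, υ x' = y →
      x' ∈ ((strictTransformIdeal υ (vanishingIdeal ⟨{y}, hy⟩) 𝓢).support : Set G₂) →
      stalkIdeal (strictTransformIdeal υ (vanishingIdeal ⟨{y}, hy⟩) (𝓢 ⊔ K)) x' =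
        stalkIdeal (strictTransformIdeal υ (vanishingIdeal ⟨{y}, hy⟩) 𝓢) x' ⊔
          stalkIdeal (strictTransformIdeal υ (vanishingIdeal ⟨{y}, hy⟩) K) x' := by
    intro x' hx hxS
    subst hx
    have hxJ : υ x' ∈ ((vanishingIdeal (⟨{υ x'}, hy⟩ : Closeds G)).support : Set G) := by
      rw [Scheme.IdealSheafData.coe_support_vanishingIdeal]; exact Set.mem_singleton _
    have hcJ : Ideal.span (Set.range c) = stalkIdeal (vanishingIdeal (⟨{υ x'}, hy⟩ : Closeds G)) (υ x') := by
      rw [hc𝔪, stalkIdeal_vanishingIdeal_singleton]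
    exact stalkIdeal_strictTransformIdeal_sup_eq_sup hυ 𝓢 K x' hxJ c hcJ hc hcb h𝓢 Φ hΦd hΦ hK hxS
  rw [strictTransformIdeal_sup_eq_vanishingIdeal_point_of_mem_support υ hy hυ 𝓢 K (closure Z) isClosed_closure hD hstalk]
  congr 1
  ext1
  exact closure_preimage_closure_diff_singleton hy hυ Z

/-! ## 2. T-PACK-DESCENT: the downstairs cone pack from the upstairs centred package along a model square -/

section Descent

variable (O : Type) [CommRing O] [IsDomain O] [IsDiscreteValuationRing O] (k : Type) [Field k]
  (θ : O →+* k) (hθ : Function.Surjective θ) {X' F₁ : Scheme.{0}} (r' : X' ⟶ Spec (.of O))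
  (j : F₁ ⟶ X') (t : F₁ ⟶ Spec (.of k)) (hsq : IsPullback j t r' (Spec.map (CommRingCat.ofHom θ))) (x : F₁)
  (ϖ : O) (hϖ : Irreducible ϖ)

/-- **`Φ ≢ 0 mod 𝔪_p` descends** (any variable set): if `I = 𝔪_x` then the reduction of `j^♯ Φ` modulo `I` is non-zero as soon as
`Φ ≢ 0 mod 𝔪_{j x}` (`κ(j x) → κ(x)` is a ring map out of a field). Variant of res-D-pv-029's `map_mk_map_stalkMap_ne_zero` (p520689) for a cone
in the TAIL variables of the frame. [folklore] -/
theorem map_mk_map_stalkMap_ne_zero_of_eq_maximalIdeal {X' F₁ : Scheme.{0}} (j : F₁ ⟶ X') (x : F₁)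
    (I : Ideal (F₁.presheaf.stalk x)) (hI : I = maximalIdeal (F₁.presheaf.stalk x)) {σ : Type*}
    (Φ : MvPolynomial σ (X'.presheaf.stalk (j x))) (hΦ𝔪 : MvPolynomial.map (residue (X'.presheaf.stalk (j x))) Φ ≠ 0) :
    MvPolynomial.map (Ideal.Quotient.mk I) (MvPolynomial.map (j.stalkMap x).hom Φ) ≠ 0 := by
  subst hI
  letI : Field (F₁.presheaf.stalk x ⧸ maximalIdeal (F₁.presheaf.stalk x)) := Ideal.Quotient.field _
  letI : Field (X'.presheaf.stalk (j x) ⧸ maximalIdeal (X'.presheaf.stalk (j x))) := Ideal.Quotient.field _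
  have hle : maximalIdeal (X'.presheaf.stalk (j x)) ≤ (maximalIdeal (F₁.presheaf.stalk x)).comap (j.stalkMap x).hom :=
    fun a ha => by
      rw [Ideal.mem_comap]
      exact map_nonunit (j.stalkMap x).hom a ha
  have hfac : (Ideal.Quotient.mk (maximalIdeal (F₁.presheaf.stalk x))).comp (j.stalkMap x).hom =
      (Ideal.quotientMap _ (j.stalkMap x).hom hle).comp (residue (X'.presheaf.stalk (j x))) := by
    ext a; rfl
  rw [MvPolynomial.map_map, hfac, ← MvPolynomial.map_map]
  intro h
  exact hΦ𝔪 (MvPolynomial.map_injective _ (RingHom.injective _) (h.trans (map_zero _).symm))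

include hθ hsq hϖ in
/-- **The tail of a descended frame stays quasi-regular modulo its head.** In a model square over a DVR, for a frame `c` at `j x` with
`𝒪/(c)` a domain not containing `ϖ` and tail quasi-regular modulo `c₀`, the images under `j^♯_x` have tail quasi-regular modulo the
image of `c₀` (`((c)/(c₀) : ϖ) = (c)/(c₀)`, Matsumura 16.2 (ii) in the form `IsQuasiRegular.comp_of_surjective`). [cite: Matsumura1987, Thm. 16.2] -/
theorem isQuasiRegular_tail_stalkMap_model {r : ℕ} (c : Fin (r + 1) → X'.presheaf.stalk (j x))
    [IsDomain (X'.presheaf.stalk (j x) ⧸ Ideal.span (Set.range c))]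
    (hcb : IsQuasiRegular fun l : Fin r => Ideal.Quotient.mk (Ideal.span {c 0}) (c l.succ))
    (hϖc : (X'.presheaf.Γgerm (j x)).hom (r'.appTop.hom ((Scheme.ΓSpecIso (.of O)).inv.hom ϖ)) ∉ Ideal.span (Set.range c)) :
    IsQuasiRegular fun l : Fin r =>
      Ideal.Quotient.mk (Ideal.span {(j.stalkMap x).hom (c 0)}) ((j.stalkMap x).hom (c l.succ)) := by
  classical
  set w := (X'.presheaf.Γgerm (j x)).hom (r'.appTop.hom ((Scheme.ΓSpecIso (.of O)).inv.hom ϖ)) with hw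
  have hsurj : Function.Surjective (j.stalkMap x).hom := stalkMap_model_surjective θ hθ r' j t hsq x
  have hφw : (j.stalkMap x).hom w = 0 :=
    stalkMap_model_varpi θ hθ r' j t hsq x ϖ (hϖ.maximalIdeal_eq ▸ Ideal.mem_span_singleton_self ϖ)
  have hker : RingHom.ker (j.stalkMap x).hom ≤ Ideal.span {w} := ker_stalkMap_model_le O k θ hθ r' j t hsq x ϖ hϖ
  -- the induced map `R/(c₀) → 𝒪_{F₁,x}/(φ c₀)`
  have hle : Ideal.span {c 0} ≤ (Ideal.span {(j.stalkMap x).hom (c 0)}).comap (j.stalkMap x).hom := by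
    rw [Ideal.span_singleton_le_iff_mem, Ideal.mem_comap]; exact Ideal.mem_span_singleton_self _
  set f : X'.presheaf.stalk (j x) ⧸ Ideal.span {c 0} →+* F₁.presheaf.stalk x ⧸ Ideal.span {(j.stalkMap x).hom (c 0)} :=
    Ideal.quotientMap _ (j.stalkMap x).hom hle with hf
  have hfsurj : Function.Surjective f := Ideal.quotientMap_surjective hsurj
  -- the tail ideal upstairs is `(c)/(c₀)`
  have htail : Ideal.span (Set.range fun l : Fin r => Ideal.Quotient.mk (Ideal.span {c 0}) (c l.succ)) =
      (Ideal.span (Set.range c)).map (Ideal.Quotient.mk (Ideal.span {c 0})) := by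
    apply le_antisymm
    · rw [Ideal.span_le]
      rintro _ ⟨l, rfl⟩
      exact Ideal.mem_map_of_mem _ (Ideal.subset_span ⟨l.succ, rfl⟩)
    · rw [Ideal.map_span, Ideal.span_le]
      rintro _ ⟨_, ⟨i, rfl⟩, rfl⟩
      refine Fin.cases ?_ (fun l => ?_) i
      · rw [Ideal.Quotient.eq_zero_iff_mem.mpr (Ideal.mem_span_singleton_self _)]; exact Ideal.zero_mem _
      · exact Ideal.subset_span ⟨l, rfl⟩
  refine IsQuasiRegular.comp_of_surjective hcb (a := Ideal.Quotient.mk (Ideal.span {c 0}) w) ?_ f hfsurj ?_ ?_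
  · -- `((c)/(c₀) : ϖ̄) = (c)/(c₀)`: `𝒪/(c)` is a domain and `ϖ ∉ (c)`
    intro y hy
    obtain ⟨y, rfl⟩ := Ideal.Quotient.mk_surjective y
    rw [htail] at hy ⊢
    rw [← map_mul, Ideal.mem_map_iff_of_surjective _ Ideal.Quotient.mk_surjective] at hy
    obtain ⟨z, hz, hzy⟩ := hy
    rw [Ideal.Quotient.eq] at hzy
    have hc0 : Ideal.span {c 0} ≤ Ideal.span (Set.range c) :=
      (Ideal.span_singleton_le_iff_mem _).mpr (Ideal.subset_span (Set.mem_range_self 0))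
    have hwy : w * y ∈ Ideal.span (Set.range c) := by
      have h1 : z - (z - w * y) ∈ Ideal.span (Set.range c) := Ideal.sub_mem _ hz (hc0 hzy)
      simpa using h1
    have h0 : Ideal.Quotient.mk (Ideal.span (Set.range c)) w ≠ 0 := fun h => hϖc (Ideal.Quotient.eq_zero_iff_mem.mp h)
    have hy' : y ∈ Ideal.span (Set.range c) := by
      have h2 : Ideal.Quotient.mk (Ideal.span (Set.range c)) (w * y) = 0 := Ideal.Quotient.eq_zero_iff_mem.mpr hwy
      rw [map_mul, mul_eq_zero] at h2
      exact Ideal.Quotient.eq_zero_iff_mem.mp (h2.resolve_left h0)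
    exact Ideal.mem_map_of_mem _ hy'
  · -- `f ϖ̄ = 0`
    rw [hf, Ideal.quotientMap_mk, hφw, map_zero]
  · -- `ker f ⊆ (ϖ̄)`
    intro z hz
    obtain ⟨z, rfl⟩ := Ideal.Quotient.mk_surjective z
    rw [RingHom.mem_ker, hf, Ideal.quotientMap_mk, Ideal.Quotient.eq_zero_iff_mem, Ideal.mem_span_singleton] at hz
    obtain ⟨s, hs⟩ := hz
    obtain ⟨u, rfl⟩ := hsurj s
    have hk : z - c 0 * u ∈ RingHom.ker (j.stalkMap x).hom := by
      rw [RingHom.mem_ker, map_sub, map_mul, hs, sub_self]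
    have hk' := hker hk
    rw [Ideal.mem_span_singleton] at hk' ⊢
    obtain ⟨v, hv⟩ := hk'
    refine ⟨Ideal.Quotient.mk _ v, ?_⟩
    have h0 : Ideal.Quotient.mk (Ideal.span {c 0}) (c 0 * u) = 0 :=
      Ideal.Quotient.eq_zero_iff_mem.mpr (Ideal.mul_mem_right _ _ (Ideal.mem_span_singleton_self _))
    rw [← map_mul, ← hv, map_sub, h0, sub_zero]

include hθ hsq hϖ in
/-- **T-PACK-DESCENT: the downstairs cone pack of an upstairs centred package.** See the module docstring. [cite: Matsumura1987, Thm. 16.2]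
[OURS · L1 W4.5b] brick K7e toward `stub_elnat_tcPlusPointResolution` (stmt-ResolutionOfSingularities-20148 / -20038); NOT a statement of the
manuscript. -/
theorem conePack_stalkMap_of_model {r : ℕ} (c : Fin (r + 1) → X'.presheaf.stalk (j x)) (hc : IsQuasiRegular c)
    [IsDomain (X'.presheaf.stalk (j x) ⧸ Ideal.span (Set.range c))]
    (hcb : IsQuasiRegular fun l : Fin r => Ideal.Quotient.mk (Ideal.span {c 0}) (c l.succ))
    (hϖc : (X'.presheaf.Γgerm (j x)).hom (r'.appTop.hom ((Scheme.ΓSpecIso (.of O)).inv.hom ϖ)) ∉ Ideal.span (Set.range c))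
    (h𝔪 : Ideal.span (Set.range c) ⊔
      Ideal.span {(X'.presheaf.Γgerm (j x)).hom (r'.appTop.hom ((Scheme.ΓSpecIso (.of O)).inv.hom ϖ))} =
        maximalIdeal (X'.presheaf.stalk (j x)))
    (𝓢 K : X'.IdealSheafData) (h𝓢 : stalkIdeal 𝓢 (j x) = Ideal.span {c 0})
    {d : ℕ} (Φ : MvPolynomial (Fin r) (X'.presheaf.stalk (j x))) (hΦd : Φ.IsHomogeneous d)
    (hK : stalkIdeal K (j x) = Ideal.span {MvPolynomial.eval (fun l => c l.succ) Φ})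
    (hΦ𝔪 : MvPolynomial.map (IsLocalRing.residue (X'.presheaf.stalk (j x))) Φ ≠ 0) :
    Ideal.span (Set.range fun i => (j.stalkMap x).hom (c i)) = maximalIdeal (F₁.presheaf.stalk x) ∧
    IsQuasiRegular (fun i => (j.stalkMap x).hom (c i)) ∧
    IsQuasiRegular (fun l : Fin r =>
      Ideal.Quotient.mk (Ideal.span {(j.stalkMap x).hom (c 0)}) ((j.stalkMap x).hom (c l.succ))) ∧
    stalkIdeal (𝓢.comap j) x = Ideal.span {(j.stalkMap x).hom (c 0)} ∧
    (MvPolynomial.map (j.stalkMap x).hom Φ).IsHomogeneous d ∧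
    MvPolynomial.map (Ideal.Quotient.mk (Ideal.span (Set.range fun i => (j.stalkMap x).hom (c i))))
      (MvPolynomial.map (j.stalkMap x).hom Φ) ≠ 0 ∧
    stalkIdeal (K.comap j) x =
      Ideal.span {MvPolynomial.eval (fun l => (j.stalkMap x).hom (c l.succ)) (MvPolynomial.map (j.stalkMap x).hom Φ)} := by
  have hc𝔪 := span_stalkMap_eq_maximalIdeal_of_model θ hθ r' j t hsq x ϖ
    (hϖ.maximalIdeal_eq ▸ Ideal.mem_span_singleton_self ϖ) c h𝔪
  refine ⟨hc𝔪, isQuasiRegular_stalkMap_model O k θ hθ r' j t hsq x c hc ϖ hϖ hϖc,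
    isQuasiRegular_tail_stalkMap_model O k θ hθ r' j t hsq x ϖ hϖ c hcb hϖc, ?_, hΦd.map _,
    map_mk_map_stalkMap_ne_zero_of_eq_maximalIdeal j x _ hc𝔪 Φ hΦ𝔪, ?_⟩
  · rw [stalkIdeal_comap_eq_map_stalkMap, h𝓢, Ideal.map_span, Set.image_singleton]
  · rw [stalkIdeal_comap_eq_map_stalkMap, hK, Ideal.map_span, Set.image_singleton, ringHom_eval_eq_eval_map]

end Descent

/-! ## 3. `inv_step_singular` (i) downstairs: the two combined -/

/-- **Exactness downstairs after the blow-up of a CENTRED point, from the upstairs package.** Model square `j : F₁ → X′` over `Spec θ`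
(`O` a DVR with uniformizer `ϖ`), `x ∈ F₁` closed, `υ : F₂ → F₁` the blow-up of `𝓘{x}`; upstairs at `j x` the centred package data for
`(𝓢, K)` (frame `c` of `(c) + (ϖ) = 𝔪`, `ϖ ∉ (c)`, `𝒪/(c)` a domain, tail quasi-regular mod `c₀`, `𝓢 = (c₀)`, `K = (Φ(tail))`, `Φ ≢ 0 mod 𝔪`);
downstairs `(𝓢 ⊔ K).comap j = 𝓘⟨closure Z⟩`. Then `St_υ(𝓢.comap j) ⊔ St_υ(K.comap j) = 𝓘⟨closure υ⁻¹(Z ∖ {x})⟩`.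
[cite: Matsumura1987, Thm. 16.2] [cite: GortzWedhorn2020, Prop. 13.96] [OURS · L1 W4.5b] brick K7e = `inv_step_singular` (i) downstairs, toward
`stub_elnat_tcPlusPointResolution` (stmt-ResolutionOfSingularities-20148 / -20038); NOT a statement of the manuscript. -/
theorem strictTransformIdeal_comap_sup_eq_vanishingIdeal_of_centredPackage (O : Type) [CommRing O] [IsDomain O]
    [IsDiscreteValuationRing O] (k : Type) [Field k] (θ : O →+* k) (hθ : Function.Surjective θ) {X' F₁ F₂ : Scheme.{0}}
    [IsLocallyNoetherian F₁] (r' : X' ⟶ Spec (.of O)) (j : F₁ ⟶ X') (t : F₁ ⟶ Spec (.of k))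
    (hsq : IsPullback j t r' (Spec.map (CommRingCat.ofHom θ))) (x : F₁) (hx : IsClosed ({x} : Set F₁))
    (υ : F₂ ⟶ F₁) (hυ : IsBlowup υ (vanishingIdeal ⟨{x}, hx⟩)) (ϖ : O) (hϖ : Irreducible ϖ)
    {r : ℕ} (c : Fin (r + 1) → X'.presheaf.stalk (j x)) (hc : IsQuasiRegular c)
    [IsDomain (X'.presheaf.stalk (j x) ⧸ Ideal.span (Set.range c))]
    (hcb : IsQuasiRegular fun l : Fin r => Ideal.Quotient.mk (Ideal.span {c 0}) (c l.succ))
    (hϖc : (X'.presheaf.Γgerm (j x)).hom (r'.appTop.hom ((Scheme.ΓSpecIso (.of O)).inv.hom ϖ)) ∉ Ideal.span (Set.range c))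
    (h𝔪 : Ideal.span (Set.range c) ⊔
      Ideal.span {(X'.presheaf.Γgerm (j x)).hom (r'.appTop.hom ((Scheme.ΓSpecIso (.of O)).inv.hom ϖ))} =
        maximalIdeal (X'.presheaf.stalk (j x)))
    (𝓢 K : X'.IdealSheafData) (h𝓢 : stalkIdeal 𝓢 (j x) = Ideal.span {c 0})
    {d : ℕ} (Φ : MvPolynomial (Fin r) (X'.presheaf.stalk (j x))) (hΦd : Φ.IsHomogeneous d)
    (hK : stalkIdeal K (j x) = Ideal.span {MvPolynomial.eval (fun l => c l.succ) Φ})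
    (hΦ𝔪 : MvPolynomial.map (IsLocalRing.residue (X'.presheaf.stalk (j x))) Φ ≠ 0)
    (Z : Set F₁) (hD : (𝓢 ⊔ K).comap j = vanishingIdeal ⟨closure Z, isClosed_closure⟩) :
    strictTransformIdeal υ (vanishingIdeal ⟨{x}, hx⟩) (𝓢.comap j) ⊔
        strictTransformIdeal υ (vanishingIdeal ⟨{x}, hx⟩) (K.comap j) =
      vanishingIdeal ⟨closure (υ ⁻¹' (Z \ {x})), isClosed_closure⟩ := by
  obtain ⟨hc𝔪, hcq, hcbq, h𝓢', hΦd', hΦ', hK'⟩ :=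
    conePack_stalkMap_of_model O k θ hθ r' j t hsq x ϖ hϖ c hc hcb hϖc h𝔪 𝓢 K h𝓢 Φ hΦd hK hΦ𝔪
  have hD' : 𝓢.comap j ⊔ K.comap j = vanishingIdeal ⟨closure Z, isClosed_closure⟩ := by
    rw [← Scheme.IdealSheafData.comap_sup]; exact hD
  exact strictTransformIdeal_sup_eq_vanishingIdeal_of_conePack υ hx hυ (𝓢.comap j) (K.comap j)
    (fun i => (j.stalkMap x).hom (c i)) hc𝔪 hcq hcbq h𝓢' (MvPolynomial.map (j.stalkMap x).hom Φ) hΦd' hΦ' hK' Z hD'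

end Summit.ResolutionOfSingularities.ResolutionOfSingularities.Cruxes.EquisingularLiftNat.Sections

end
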